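import Summits.QuantumAdvantage.QuantumAdvantage.Theorems.SosSandwichTransferPBMachineReduction
import HarnessLib

/-!
# Crux `TransferPB` (stmt-QuantumAdvantage-15238, route SosSandwich), line `birth` — the machine reduction of `stub_pbOracleSimulation`, ADVISOR FORM

Companion of `Theorems/SosSandwichTransferPBMachineReduction.lean` (`stub_pbOracleSimulation_of_machines`: the
stub from one explicit machine hypothesis, the machine computing the threshold bit of the advised tree of the
no-variance gapped advisor `gapAdvisor ⟨true, infBig, est⟩`, which queries the LEAST variable whose influence
test passes). A polynomial-time machine with a promise oracle cannot scan the exponentially many relevant oracle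
bits for the least passing index: it finds candidates by heavy-prefix descent on (BBBV) query magnitudes and picks
SOME candidate whose gapped influence test passes. The analysis of Aaronson–Ambainis' Thm. 21 needs only what
such a pick certifies — `Inf_i[p_x|_ρ] ≥ w/2` for a pick, `Inf_i[p_x|_ρ] < w` for every `i` at a refusal —
so this file restates the reduction at the level of an arbitrary path-indexed ADVISOR with pick-faithfulness:

* `advisor_sound_of_pickFaithful` — pick-faithful advisors with `η`-accurate leaf values are sound
  `(θ, w/2, η)` granted completeness (`Var > θ/2 ⇒ ∃ Inf_i ≥ w`, supplied by PB-AA along restrictions);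
* **`oracleSimulation_of_pickMachines`**, **`stub_pbOracleSimulation_of_pickMachines`** — the stub from the
  machine hypothesis in advisor form (same explicit parameters `δ = 1/(r(n)+1)`, `θ = (1/10)²δ/2`,
  `w = 2^{-k}((θ/2)/d)^c`, `d = thm23Degree F x`, budget `⌈8d/((w/2)δ)⌉`).

All proved; no named fact (the machine hypothesis is a plain `Prop` argument, D-0026). What remains for the
stub is that hypothesis: one promise problem in `PromiseBQP` encoding gapped influence tests / mean thresholds /
query-magnitude block tests of restricted acceptance probabilities, and one polynomial-time transcript machine
walking the advised tree with the combined oracle `A ⊕ g`. Source: S. Aaronson, A. Ambainis, Theory Comput. 10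
(2014), Thm. 21, Thm. 23 and its proof (arXiv:0911.0996v3 pp. 13–14); C. H. Bennett, E. Bernstein,
G. Brassard, U. Vazirani, SIAM J. Comput. 26 (1997), Thm. 3.3 (query magnitudes; the intended candidate search).
-/

-- D-0017: single-conjunct summit ⇒ the duplicate `QuantumAdvantage.QuantumAdvantage` is mandated.
set_option linter.dupNamespace false

noncomputable section

namespace Summit.QuantumAdvantage.QuantumAdvantage.Cruxes.TransferPB.Birth

open Finset MeasureTheory Literature.Computability.Cryptography Literature.Computability.Complexity
  Literature.Computability.QuantumComplexity Literature.Computability.QuantumComplexity.ClassicalSimulation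
open Summit.QuantumAdvantage.QuantumAdvantage.Theses.SosSandwich
open scoped ENNReal

namespace SimTreePB

/-! ### The reduction, advisor form (no least-index rule)

A transcript machine that finds an influential variable by heavy-prefix descent (BBBV query magnitudes) and
then tests candidates picks SOME variable whose influence test passed — not necessarily the least one. The
analysis needs only this: a pick certifies `Inf > w/2`, a refusal certifies that no variable has `Inf ≥ w`.
So the machine hypothesis is restated at the level of an ADVISOR with pick-faithfulness; the table form
`oracleSimulation_of_machines` is the special case `gapAdvisor ⟨true, infBig, est⟩`. -/

section PickForm

variable {N : ℕ}

/-- **Pick-faithful advisors are sound.** If a pick certifies influence `≥ w/2`, a refusal certifies that every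
influence is `< w`, leaf values are `η`-accurate, and COMPLETENESS holds (`Var > θ/2 ⇒ ∃ Inf_i ≥ w`), then the
advisor is sound `(θ, w/2, η)` (`θ ≥ 0`). [cite: AaronsonAmbainis2014, Thm. 21 (proof) and Thm. 23 (proof, p. 14)] -/
theorem advisor_sound_of_pickFaithful {Adv : Advisor N} {p : MvPolynomial (Fin N) ℝ} {θ w η : ℝ} (hθ : 0 ≤ θ)
    (hpick : ∀ (ρ : List (Fin N × Bool)) (i : Fin N), Adv.pick ρ = some i → w / 2 ≤ influence i (restrictPath ρ p))
    (hnone : ∀ ρ : List (Fin N × Bool), Adv.pick ρ = none → ∀ i : Fin N, influence i (restrictPath ρ p) < w)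
    (hval : ∀ ρ : List (Fin N × Bool), |Adv.val ρ - boolAvg (evalBool (restrictPath ρ p))| ≤ η)
    (hcomplete : ∀ ρ : List (Fin N × Bool), θ / 2 < boolVariance (restrictPath ρ p) →
      ∃ i : Fin N, w ≤ influence i (restrictPath ρ p)) :
    Adv.Sound p θ (w / 2) η := by
  refine ⟨hpick, fun ρ hρ => ?_, hval⟩
  by_contra hbig
  have hbig' : θ / 2 < boolVariance (restrictPath ρ p) := by
    have : θ / 2 ≤ θ := by linarith
    exact lt_of_le_of_lt this (not_le.1 hbig)
  obtain ⟨i, hi⟩ := hcomplete ρ hbig'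
  exact absurd (hnone ρ hρ i) (not_lt.2 hi)

end PickForm

/-- **`OracleSimulation` from the machine half, advisor form.** As `oracleSimulation_of_machines`, but the
machine may compute the threshold bit of the advised tree of ANY path-indexed advisor whose picks certify
`Inf_i[p_x|_ρ] ≥ w/2`, whose refusals certify `Inf_i[p_x|_ρ] < w` for all `i`, and whose leaf values are
`1/20`-accurate means — at the explicit parameters `δ = 1/(r(n)+1)`, `θ = (1/10)²δ/2`,
`w = 2^{-k}((θ/2)/d)^c`, `d = thm23Degree F x`, budget `⌈8d/((w/2)δ)⌉`. (The form a heavy-prefix-descent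
machine delivers: it picks some passing candidate, not the least index.) [cite: AaronsonAmbainis2014, Thm. 23 (proof, p. 14)] -/
theorem oracleSimulation_of_pickMachines
    (hmach : ∀ (c k : ℕ) (F : QCircuitFamily cliffordT), F.IsUniform → ∀ r : Polynomial ℕ,
      ∃ Q ∈ Literature.Computability.Cryptography.PromiseBQP, ∃ (C : OracleAlg Bool) (q : Polynomial ℕ),
        C.IsPolyTime Computability.encodingBoolBool ∧
        (∀ (O : Oracle) (x : List Bool), ∀ y ∈ C.queries O (q.eval x.length) x, y.length ≤ q.eval x.length) ∧
        ∀ x : List Bool, 1 ≤ x.length → ∀ g : List Bool → Bool,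
          (∀ v ∈ Q.yes, g v = true) → (∀ v ∈ Q.no, g v = false) →
          ∃ Adv : Advisor (numOracleBits F x),
            (∀ (ρ : List (Fin (numOracleBits F x) × Bool)) (i : Fin (numOracleBits F x)), Adv.pick ρ = some i →
              ((1 / 2 ^ k : ℝ) * ((((1 / 10 : ℝ) ^ 2 * (1 / (((r.eval x.length : ℕ) : ℝ) + 1)) / 2) / 2) /
                    thm23Degree F x) ^ c) / 2 ≤ influence i (restrictPath ρ (acceptPoly F x))) ∧
            (∀ ρ : List (Fin (numOracleBits F x) × Bool), Adv.pick ρ = none → ∀ i : Fin (numOracleBits F x),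
              influence i (restrictPath ρ (acceptPoly F x)) <
                (1 / 2 ^ k : ℝ) * ((((1 / 10 : ℝ) ^ 2 * (1 / (((r.eval x.length : ℕ) : ℝ) + 1)) / 2) / 2) /
                    thm23Degree F x) ^ c) ∧
            (∀ ρ : List (Fin (numOracleBits F x) × Bool),
              |Adv.val ρ - boolAvg (evalBool (restrictPath ρ (acceptPoly F x)))| ≤ 1 / 20) ∧
            ∀ A : Set (List Bool),
              C.run (Oracle.ofLanguage {w : List Bool | ∃ v : List Bool,
                  (w = false :: v ∧ v ∈ A) ∨ (w = true :: v ∧ g v = true)}) (q.eval x.length) x =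
                some (decide (1 / 2 ≤
                  (advTree Adv
                    (Nat.ceil (8 * (thm23Degree F x : ℝ) /
                      (((1 / 2 ^ k : ℝ) * ((((1 / 10 : ℝ) ^ 2 * (1 / (((r.eval x.length : ℕ) : ℝ) + 1)) / 2) / 2) /
                          thm23Degree F x) ^ c) / 2 * (1 / (((r.eval x.length : ℕ) : ℝ) + 1)))))
                    []).eval (oracleBits F x A)))) :
    Sig.stub_oracleAcceptPseudoBounded → PseudoBoundedAA → OracleSimulation := by
  intro h₁ hPB F hF r
  obtain ⟨c, C₀, hC₀, HPB⟩ := pbInfluenceBound_of_pseudoBoundedAA hPB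
  obtain ⟨k, HPBk⟩ := pbBound_dyadic hC₀ HPB
  obtain ⟨Q, hQ, C, q, hCpoly, hCq, hC⟩ := hmach c k F hF r
  refine ⟨Q, hQ, C, q, hCpoly, hCq, fun x hx g hgy hgn => ?_⟩
  obtain ⟨Adv, hpick, hnone, hval, hrun⟩ := hC x hx g hgy hgn
  -- parameters
  set δ : ℝ := 1 / (((r.eval x.length : ℕ) : ℝ) + 1) with hδ
  have hδpos : 0 < δ := by positivity
  have hε : (0 : ℝ) < 1 / 10 := by norm_num
  have hCk : (0 : ℝ) < 1 / 2 ^ k := by positivity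
  have hd1 : 1 ≤ thm23Degree F x := by unfold thm23Degree; omega
  have hTd : (F.circ x.length).oracleQueries ≤ thm23Degree F x := by unfold thm23Degree; omega
  have hdeg : (acceptPoly F x).totalDegree ≤ thm23Degree F x :=
    (totalDegree_acceptPoly_le F x).trans (by unfold thm23Degree; omega)
  set θ : ℝ := (1 / 10 : ℝ) ^ 2 * δ / 2 with hθ
  have hθpos : 0 < θ := by positivity
  set w : ℝ := (1 / 2 ^ k : ℝ) * ((θ / 2) / thm23Degree F x) ^ c with hw
  have hwpos : 0 < w := by positivity
  set D : ℕ := Nat.ceil (8 * (thm23Degree F x : ℝ) / (w / 2 * δ)) with hD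
  have hDle : 8 * (thm23Degree F x : ℝ) / (w / 2 * δ) ≤ D := Nat.le_ceil _
  have hK := h₁ F x
  have hcomplete := complete_of_pb (N := numOracleBits F x) (c := c) (C := (1 / 2 ^ k : ℝ)) hTd
    (fun q' ε' hq hε' hv => HPBk _ _ q' ε' hd1 hq hε' hv) hK hθpos
  have hS : Adv.Sound (acceptPoly F x) θ (w / 2) (1 / 20) :=
    advisor_sound_of_pickFaithful hθpos.le hpick hnone hval hcomplete
  have hdev := measure_advTree_acceptPoly_deviation_le F x hd1 hdeg (hK.mono hTd).bounded hε hδpos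
    (half_pos hwpos) hS (D := D) hDle
  have hsub := threshold_subset_deviation F x (advTree Adv D []) (ε := 1 / 10) (η := 1 / 20) (by norm_num)
  have hset : {A : Set (List Bool) |
      (2 / 3 ≤ F.acceptProbOn A x ∧
        C.run (Oracle.ofLanguage {w : List Bool | ∃ v : List Bool,
            (w = false :: v ∧ v ∈ A) ∨ (w = true :: v ∧ g v = true)}) (q.eval x.length) x ≠ some true) ∨
      (F.acceptProbOn A x ≤ 1 / 3 ∧
        C.run (Oracle.ofLanguage {w : List Bool | ∃ v : List Bool,
            (w = false :: v ∧ v ∈ A) ∨ (w = true :: v ∧ g v = true)}) (q.eval x.length) x ≠ some false)} =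
      {A : Set (List Bool) |
        (2 / 3 ≤ F.acceptProbOn A x ∧ decide (1 / 2 ≤ (advTree Adv D []).eval (oracleBits F x A)) ≠ true) ∨
          (F.acceptProbOn A x ≤ 1 / 3 ∧
            decide (1 / 2 ≤ (advTree Adv D []).eval (oracleBits F x A)) ≠ false)} := by
    ext A
    simp only [Set.mem_setOf_eq, hrun A, ne_eq, Option.some.injEq]
  show (ProbabilityTheory.setBernoulli (Set.univ : Set (List Bool)) ⟨1 / 2, by norm_num, by norm_num⟩) _ ≤ _
  change randomOracleMeasure _ ≤ _
  rw [hset]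
  exact (measure_mono hsub).trans hdev

/-- **Stub `stub_pbOracleSimulation` from its machine, advisor form** (see `oracleSimulation_of_pickMachines`).
[cite: AaronsonAmbainis2014, Thm. 23 (proof, p. 14)] -/
theorem stub_pbOracleSimulation_of_pickMachines
    (hmach : ∀ (c k : ℕ) (F : QCircuitFamily cliffordT), F.IsUniform → ∀ r : Polynomial ℕ,
      ∃ Q ∈ Literature.Computability.Cryptography.PromiseBQP, ∃ (C : OracleAlg Bool) (q : Polynomial ℕ),
        C.IsPolyTime Computability.encodingBoolBool ∧
        (∀ (O : Oracle) (x : List Bool), ∀ y ∈ C.queries O (q.eval x.length) x, y.length ≤ q.eval x.length) ∧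
        ∀ x : List Bool, 1 ≤ x.length → ∀ g : List Bool → Bool,
          (∀ v ∈ Q.yes, g v = true) → (∀ v ∈ Q.no, g v = false) →
          ∃ Adv : Advisor (numOracleBits F x),
            (∀ (ρ : List (Fin (numOracleBits F x) × Bool)) (i : Fin (numOracleBits F x)), Adv.pick ρ = some i →
              ((1 / 2 ^ k : ℝ) * ((((1 / 10 : ℝ) ^ 2 * (1 / (((r.eval x.length : ℕ) : ℝ) + 1)) / 2) / 2) /
                    thm23Degree F x) ^ c) / 2 ≤ influence i (restrictPath ρ (acceptPoly F x))) ∧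
            (∀ ρ : List (Fin (numOracleBits F x) × Bool), Adv.pick ρ = none → ∀ i : Fin (numOracleBits F x),
              influence i (restrictPath ρ (acceptPoly F x)) <
                (1 / 2 ^ k : ℝ) * ((((1 / 10 : ℝ) ^ 2 * (1 / (((r.eval x.length : ℕ) : ℝ) + 1)) / 2) / 2) /
                    thm23Degree F x) ^ c) ∧
            (∀ ρ : List (Fin (numOracleBits F x) × Bool),
              |Adv.val ρ - boolAvg (evalBool (restrictPath ρ (acceptPoly F x)))| ≤ 1 / 20) ∧
            ∀ A : Set (List Bool),
              C.run (Oracle.ofLanguage {w : List Bool | ∃ v : List Bool,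
                  (w = false :: v ∧ v ∈ A) ∨ (w = true :: v ∧ g v = true)}) (q.eval x.length) x =
                some (decide (1 / 2 ≤
                  (advTree Adv
                    (Nat.ceil (8 * (thm23Degree F x : ℝ) /
                      (((1 / 2 ^ k : ℝ) * ((((1 / 10 : ℝ) ^ 2 * (1 / (((r.eval x.length : ℕ) : ℝ) + 1)) / 2) / 2) /
                          thm23Degree F x) ^ c) / 2 * (1 / (((r.eval x.length : ℕ) : ℝ) + 1)))))
                    []).eval (oracleBits F x A)))) :
    Sig.stub_pbOracleSimulation :=
  oracleSimulation_of_pickMachines hmach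

end SimTreePB

end Summit.QuantumAdvantage.QuantumAdvantage.Cruxes.TransferPB.Birth

end
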